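import Summits.QuantumFields.BalabanUV.T4Continuum.Spine.NE1p.DressedSmallFieldRecordLabelsKillWitness

/-!
# T⁴ programme, spine estimate NE1′ (node O3b/H2) — WITNESS «N1a FIRES AT THE CARRIERS OF RECORD», PART 2: W91 §3's two ENDs FIRE on
# PART 1's masked letters `ℓK` for EVERY driven two-run object `D` and every standing scale — every displayed binder DECIDED

Cell `pub-balaban`, sub-cell `t4`, BINDER-OWNERS row NE1′; NE1′ formalisation crew, unit `b2b-balaban-t4-ne1p-formalise-leaf-04`
(gen 17); crew row **W96 ∕ DAG N29zzzzzi** PART 2 of 3 (D1) of `t4/formal/NE1p/LEAVES.md` (BOOKED typer R-T151, `HOME/CLAIMS.log`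
l.24469; INTENT l.24458; read X239).  ADDITIVE — imports
PART 1 `Spine/NE1p/DressedSmallFieldRecordLabelsKillWitness` ONLY (→ W91, W58 P2); THEOREMS ONLY (0 def, 0 `def … : Prop`, 0 cite,
0 sorry, 0 `attribute`); W91 §3's `attachedPart_locE_le_of_actOfLetters_recordLabels_any` and `muPart_locE_le_of_actOfLetters_recordLabels_any`
applied EXACTLY ONCE each BY NAME (`killWitnessEnd_fires`, `killWitnessMuEnd_fires`); nothing of N1a ∕ W91 ∕ W58 ∕ W24 restated.
PART 3 (`…KillWitnessLive`): the END's bounded quantity is NOT zero, and the schema HYPOTHESIS-FREE at the `SU(2)` object of record.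

WHAT.
* §6 **`killWitnessEnd_fires`**: W91 §3's attached END at `R := D.toTwoRuns`, `ℓ₀ := ℓK D k hk`, `Win := univ`, W58's centres
  `ctrW D`, radii `(ROp, RHist, R′) := (1∕2, 2, 1)`, PART 1's letters `mqK`∕`bqK`∕`N₀K` with blocks `hm_K`∕`hN_K`∕`hq_K`, `g := 0`,
  `o := 0`, `h₀ := 0`, `w := wW D`, `ϱ := 2`, `(A₀, A₁, Rkp, r₁) := (0, Acst∕2, RcK, 0)`, located clauses `(δ, κ, α₆, Rc, s, t) :=
  (1, δκK, α₆K, RcK, 0, 0)` (W24 `hrate_torus_num`, W58 `hsmall_W`, `hκ`∕`h229` with equality, `hRR` trivial at `s = 0`), PART 1's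
  `hAmp_K`; conclusion LITERAL; closed form `≤ 2·K₀(64,8)`.  **`killWitnessMuEnd_fires`**: the μ-part END likewise along the source
  pencil `sμ ↦ 0 + sμ • wW D` of radius `μ₁ := 2`, `A := Acst` (`hsmall` = W58's `hsmall_W` rearranged INLINE — no separate lemma: the
  statement `A·e^{5·0+1}·K₀·9·64 ≤ 1` is already landed elsewhere, `dedup.landed` p245668), for `0 < μ₀ < 2`, `‖sμ‖ ≤ μ₀`; closed form `≤ K₀(64,8)·μ₀∕(2 − μ₀)`.

HONEST FRAMING.  As PART 1: a DECIDED TOY ([folklore]) — OWNER RIDER (r1) (g38 l.24548,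
verbatim): «kill BY MASK χ = 𝟙_{p⋆}·cK — OURS, by fiat, exactly as W91's `killConv`; (B1b) NOT claimed; `hAmp` MET BY CHOICE of `cK` = N0y's
one-family majorant factor — (B3-form) UNPRINTED for Bałaban's cores (G-ne9p2-5)»; (r2) `labK`'s filter membership is the lattice lemma
`mem_torusLabels_iff` + `image_tcoarse_trefine` (family branch `P = ∅`, `#(Z₀ ∖ ∪fam) = 0 ≤ 2·0`), NOT a reading of p. 12 ∕ p. 18; (r3) a crew W-row —
the owner's N1b (a kill predicate READ FROM PRINT) stays RESERVED.  W58's OWN 1×1 Gaussian letters at ONE factor of record, every other factor's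
normalisation letter masked to `0` BY FIAT; (B1b) NOT claimed; (B3-form) MET because `cK` is CHOSEN as N0y's majorant factor — UNPRINTED
for Bałaban's cores (GAPS G-ne9p2-5); the μ-extension = the cell's UNPRINTED reading; every numeral OURS over pv22's located
`K₀(64,8)`∕`64 log 162`; 0 binders instantiated on Bałaban's (2.14) densities; no wall item; wall v1.8 (T4-DAG v48–v54) — words, not kind —
does NOT move; R-t4r2-Q2 NOT met thereby; NE1′ ⇐ the named binders — NOT printed, NOT proved; spine PROVED 0∕9; count 9 unchanged.
ABSOLUTE RULE honoured.  Rung (B)+1 on ONE finite four-torus — NOT infinite volume, NOT a mass gap, NOT OS on ℝ⁴, NOT Clay.  HONEST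
DEPENDENCY: continuum YM on T⁴ ⇐ BetaPertH ∧ nine spine estimates (0/9 proved); BetaPertH ⇐ (D1) ∧ (D4) ∧ CAP+tail; G-an2-4 gates
asym, D1 and NE2/3/4.
-/

noncomputable section

namespace Summit.QuantumFields.BalabanUV.T4Continuum.NE1p.DressedSmallFieldRecordLabelsKillWitness

open Set Metric MeasureTheory Complex
open scoped BigOperators
open Literature.MathematicalPhysics.QuantumFieldTheory.Balaban1983to89
open Literature.MathematicalPhysics.QuantumFieldTheory.Balaban1983to89.B12TreeDecay (K₀ K₀_pos)
open Literature.MathematicalPhysics.QuantumFieldTheory.Balaban1983to89.B13Resummation (locE)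
open Literature.MathematicalPhysics.QuantumFieldTheory.Balaban1983to89.TreeLengthTorus (TPt TDom tsys torusTreeLen torusTreeLen_singleton
  torusTreeLen_nonneg)
open Literature.MathematicalPhysics.QuantumFieldTheory.Balaban1983to89.TreeLengthTorusGeometry (tgeometry TTouch)
open Literature.MathematicalPhysics.QuantumFieldTheory.Balaban1983to89.T4WindowLevelShift.Sanity (F13)
open Summit.QuantumFields.BalabanUV.T4Continuum.B13HistDatum (level136)
open Summit.QuantumFields.BalabanUV.T4Continuum.B13HistMeasurable (MeasPotFrame B13HistM)
open Summit.QuantumFields.BalabanUV.T4Continuum.B13HistReadout (VppCLMM VppCLMM_apply)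
open Summit.QuantumFields.BalabanUV.T4Continuum.B13HistWitness (toyConsts toy_posUnits level136_toy)
open Summit.QuantumFields.BalabanUV.T4Continuum.B13Carriers (TwoRuns singleDom singleDom_val)
open Summit.QuantumFields.BalabanUV.T4Continuum.B13StepTermLabels (InnerLabel innerLabels)
open Summit.QuantumFields.BalabanUV.T4Continuum.B13InnerData (Bnd b13InnerData)
open Summit.QuantumFields.BalabanUV.T4Continuum.B13DomainGeometryTR (domEmb domEmb_apply)
open Summit.QuantumFields.BalabanUV.T4Continuum.SubstrateTwoRunsDriven (DrivenRuns)
open Summit.QuantumFields.BalabanUV.T4Continuum.SubstrateBlockAvgContinuity (drivenRecordSU one_mem_domV_drivenRecordSU)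
open Summit.QuantumFields.BalabanUV.T4Continuum.SubstrateActivities (CoreLetters coreOf actOfLetters actOfLetters_apply)
open Summit.QuantumFields.BalabanUV.T4Continuum.SubstrateNestedToriOfRecord (InnerLabel.ofTorus InnerLabel.ofTorus_injective torusLabels
  mem_torusLabels_iff fineEmb)
open Summit.QuantumFields.BalabanUV.T4Continuum.SubstrateBondsOfCubes (bondsOfFineCubes)
open Summit.QuantumFields.BalabanUV.T4Continuum.TorusBlockRefinement (trefineDom trefineDom_val image_tcoarse_trefine)
open Summit.QuantumFields.BalabanUV.T4Continuum.NE1p.DressedSmallFieldCoresWitness (E1 Acst Acst_pos)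
open Summit.QuantumFields.BalabanUV.T4Continuum.NE1p.DressedSmallFieldTorusWitness (X₀ X₀_val eq_X₀_iff hrate_torus_num exp_locE_cube)
open Summit.QuantumFields.BalabanUV.T4Continuum.NE1p.DressedSmallFieldSlotLettersWitness
open Summit.QuantumFields.BalabanUV.T4Continuum.NE1p.DressedSmallFieldSlotLettersWitnessEnd
open Summit.QuantumFields.BalabanUV.T4Continuum.NE1p.DressedSmallFieldRecordLabelsKillConvention
  (attachedPart_locE_le_of_actOfLetters_recordLabels_any muPart_locE_le_of_actOfLetters_recordLabels_any)

variable {G : Type} [GaugeGroup G] (D : DrivenRuns G) (k : ℕ) (hk : k + 1 + D.m' ≤ D.F.m + D.K)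

/-! ## §6 THE ENDs FIRE — W91 §3 (the owner's N1a PART 3 under the kill convention) ONCE each BY NAME -/

/-- Located clauses, decided: `hκ` with equality at `δ := 1`. [folklore] -/
theorem hκ_K : 64 * Real.log 162 + 1 ≤ 1 * δκK := by unfold δκK; rw [one_mul]
/-- Located clauses, decided: `h229` with equality. [folklore] -/
theorem h229_K : Real.exp 1 * K₀ 64 8 * 64 * α₆K ≤ 1 := by
  unfold α₆K; have := K₀_pos (64 : ℝ) 8; have := Real.exp_pos 1
  rw [mul_inv_cancel₀ (by positivity)]
/-- Located clauses, decided: `hrate` at `r₁ = 0`, `Rkp := RcK` (W24's `hrate_torus_num`). [folklore] -/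
theorem hrate_K : (0 : ℝ) + 2 * (64 * Real.log 162) + 2 ≤ RcK := hrate_torus_num
/-- Located clauses, decided: `hRR` is TRIVIAL at `s = 0` (no bond factor is ever charged — the live label has no bonds). [folklore] -/
theorem hRR_K : RcK ≤ RcK - 64 * (Real.exp (RcK * 5) * 0 * Real.exp ((4 * (D.F.L : ℝ) ^ (4 * D.m')) * 0)) := by simp

open Classical in
/-- (B3-form) `hAmp` in the attached END's currency `(A₀ + ϱA₁) := (0 + 2·(Acst∕2))` (PART 1's `hAmp_K`). [folklore] -/
theorem hAmp_att : ∀ Z : (tsys 4 (D.cubesPerDir (k + 1))).Dom, Z.1 ⊆ (X₀ (D.cubesPerDir (k + 1))).1 →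
    ∀ ℓ ∈ (torusLabels hk Z).filter fun ℓ =>
        ℓ.Z₀ = trefineDom D.F.L (D.cubesPerDir (k + 1)) Z ∧
          ℓ.P ⊆ bondsOfFineCubes hk (ℓ.Z₀.1 \ ℓ.fam.biUnion fun Y : (tsys 4 (D.F.L * D.cubesPerDir (k + 1))).Dom => Y.1) ∧
          (ℓ.Z₀.1 \ ℓ.fam.biUnion fun Y : (tsys 4 (D.F.L * D.cubesPerDir (k + 1))).Dom => Y.1).card ≤ 2 * ℓ.P.card,
      (coreOf (PW D) ℂ (𝒵K D) (domK D) (JcK D) (VK D) (ℓK D k hk) (domEmb D.toTwoRuns (k + 1) Z) (InnerLabel.ofTorus hk ℓ)).lam.real univ *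
          ((coreOf (PW D) ℂ (𝒵K D) (domK D) (JcK D) (VK D) (ℓK D k hk) (domEmb D.toTwoRuns (k + 1) Z) (InnerLabel.ofTorus hk ℓ)).wB *
              N₀K D k hk (k + 1) (domEmb D.toTwoRuns (k + 1) Z, InnerLabel.ofTorus hk ℓ) (domEmb D.toTwoRuns (k + 1) Z) *
            Real.exp (bqK D (k + 1) (domEmb D.toTwoRuns (k + 1) Z, InnerLabel.ofTorus hk ℓ) (domEmb D.toTwoRuns (k + 1) Z))) *
          (Real.pi / (mqK D (k + 1) (domEmb D.toTwoRuns (k + 1) Z, InnerLabel.ofTorus hk ℓ) (domEmb D.toTwoRuns (k + 1) Z) / 2)) ^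
            (Module.finrank ℝ ((VK D) (domEmb D.toTwoRuns (k + 1) Z) (InnerLabel.ofTorus hk ℓ)) / 2 : ℝ) *
        Real.exp ((coreOf (PW D) ℂ (𝒵K D) (domK D) (JcK D) (VK D) (ℓK D k hk) (domEmb D.toTwoRuns (k + 1) Z) (InnerLabel.ofTorus hk ℓ)).N₁ *
          (‖(0 : B13HistM (PW D))‖ + 2 * ‖(wW D)‖)) ≤
      (0 + 2 * (Acst / 2)) * ((∏ Y ∈ ℓ.fam, (α₆K * Real.exp (-(1 * δκK * torusTreeLen Y.1)) *
        Real.exp (-(RcK * (torusTreeLen Y.1 + 5))))) * ((0 : ℝ) ^ 2 * 0) ^ ℓ.P.card) := by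
  rw [show (0 : ℝ) + 2 * (Acst / 2) = Acst by ring]; exact hAmp_K D k hk

open Classical in
/-- **W91 §3's ATTACHED END — THE OWNER's N1a PART 3 UNDER THE KILL CONVENTION — FIRES AT THE CARRIERS OF RECORD** [decided toy], for
every driven two-run object `D`, every standing scale `hk` and every run-B background `U`: `attachedPart_locE_le_of_actOfLetters_recordLabels_any`
APPLIED ONCE BY NAME at `ℓ₀ := ℓK D k hk` with every displayed binder DECIDED (§6 header).  Conclusion LITERAL: the attached part of the
dressed small-field output of the OWNER-FILTERED catalogue sum of `ℓK`'s activities of record, at `X₀`, is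
`≤ 4·(e·9·64·K₀(64,8)²)·(Acst∕2)·e^{−0·d(X₀)}`. [folklore] -/
theorem killWitnessEnd_fires (U : D.carriers.BgB) :
    ‖locE (tgeometry 4 (D.cubesPerDir (k + 1))).ι (tgeometry 4 (D.cubesPerDir (k + 1))).cubes
          (fun Z => ∑ ℓ ∈ (torusLabels hk Z).filter fun ℓ =>
              ℓ.Z₀ = trefineDom D.F.L (D.cubesPerDir (k + 1)) Z ∧
                ℓ.P ⊆ bondsOfFineCubes hk (ℓ.Z₀.1 \ ℓ.fam.biUnion fun Y : (tsys 4 (D.F.L * D.cubesPerDir (k + 1))).Dom => Y.1) ∧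
                (ℓ.Z₀.1 \ ℓ.fam.biUnion fun Y : (tsys 4 (D.F.L * D.cubesPerDir (k + 1))).Dom => Y.1).card ≤ 2 * ℓ.P.card,
            actOfLetters (PW D) ℂ (𝒵K D) (domK D) (JcK D) (VK D) (ℓK D k hk) (domEmb D.toTwoRuns (k + 1) Z) (InnerLabel.ofTorus hk ℓ) 0
              ((0 : B13HistM (PW D)) + wW D))
            ((tgeometry 4 (D.cubesPerDir (k + 1))).cubes (X₀ (D.cubesPerDir (k + 1)))) -
        locE (tgeometry 4 (D.cubesPerDir (k + 1))).ι (tgeometry 4 (D.cubesPerDir (k + 1))).cubes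
          (fun Z => ∑ ℓ ∈ (torusLabels hk Z).filter fun ℓ =>
              ℓ.Z₀ = trefineDom D.F.L (D.cubesPerDir (k + 1)) Z ∧
                ℓ.P ⊆ bondsOfFineCubes hk (ℓ.Z₀.1 \ ℓ.fam.biUnion fun Y : (tsys 4 (D.F.L * D.cubesPerDir (k + 1))).Dom => Y.1) ∧
                (ℓ.Z₀.1 \ ℓ.fam.biUnion fun Y : (tsys 4 (D.F.L * D.cubesPerDir (k + 1))).Dom => Y.1).card ≤ 2 * ℓ.P.card,
            actOfLetters (PW D) ℂ (𝒵K D) (domK D) (JcK D) (VK D) (ℓK D k hk) (domEmb D.toTwoRuns (k + 1) Z) (InnerLabel.ofTorus hk ℓ) 0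
              (0 : B13HistM (PW D)))
            ((tgeometry 4 (D.cubesPerDir (k + 1))).cubes (X₀ (D.cubesPerDir (k + 1))))‖ ≤
      4 * (Real.exp 1 * 9 * 64 * K₀ 64 8 ^ 2) * (Acst / 2) * Real.exp (-(0 * (tsys 4 (D.cubesPerDir (k + 1))).dj (X₀ (D.cubesPerDir (k + 1))))) :=
  attachedPart_locE_le_of_actOfLetters_recordLabels_any hk (PW D) ℂ (𝒵K D) (domK D) (JcK D) (VK D) (ℓK D k hk)
    (Win := Set.univ) (ctr := ctrW D) (ROp := fun _ => 1 / 2) (RHist := fun _ => 2) (R' := fun _ => 1)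
    (mq := mqK D) (bq := bqK D) (N₀ := N₀K D k hk)
    (hroom := fun _ => by norm_num) (hm := hm_K D) (hN := hN_K D k hk) (hq := hq_K D k hk)
    (g := fun _ => 0) (hg := Set.mem_univ _) (U := U) (o := 0) (h₀ := 0) (w := wW D) (ϱ := 2)
    (hO := by show ‖(0 : ℂ) - 0‖ ≤ 1 / 2; simp)
    (hH := by show ‖(0 : B13HistM (PW D)) - 0‖ + 2 * ‖(wW D)‖ ≤ 2; rw [sub_zero, norm_zero, zero_add]; linarith [norm_wW_le D, sW_le])
    (A₀ := 0) (A₁ := Acst / 2) (Rkp := RcK) (r₁ := 0) (X₀ := X₀ (D.cubesPerDir (k + 1)))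
    (hA₀ := le_rfl) (hA₁ := by have := Acst_pos; positivity) (hr₁ := le_rfl) (hrate := hrate_K) (hsmall := hsmall_W)
    (δ := 1) (κ := δκK) (α₆ := α₆K) (Rc := RcK) (s := 0) (t := 0)
    (hα₆ := α₆K_pos.le) (hκ := hκ_K) (h229 := h229_K) (hs0 := le_rfl) (hs1 := zero_le_one) (ht := le_rfl) (hRR := hRR_K D)
    (hAmp := hAmp_att D k hk) (hϱ := le_rfl) (hϱA := by have := Acst_pos; linarith)


open Classical in
/-- … in CLOSED FORM: `≤ 4·(e·9·64·K₀(64,8)²)·(A∕2)·1 = 2·K₀(64,8)` (W33's `A` unfolded; the decay factor is `1` on the one cube). [folklore] -/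
theorem killWitnessEnd_fires_closed (U : D.carriers.BgB) :
    ‖locE (tgeometry 4 (D.cubesPerDir (k + 1))).ι (tgeometry 4 (D.cubesPerDir (k + 1))).cubes
          (fun Z => ∑ ℓ ∈ (torusLabels hk Z).filter fun ℓ =>
              ℓ.Z₀ = trefineDom D.F.L (D.cubesPerDir (k + 1)) Z ∧
                ℓ.P ⊆ bondsOfFineCubes hk (ℓ.Z₀.1 \ ℓ.fam.biUnion fun Y : (tsys 4 (D.F.L * D.cubesPerDir (k + 1))).Dom => Y.1) ∧
                (ℓ.Z₀.1 \ ℓ.fam.biUnion fun Y : (tsys 4 (D.F.L * D.cubesPerDir (k + 1))).Dom => Y.1).card ≤ 2 * ℓ.P.card,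
            actOfLetters (PW D) ℂ (𝒵K D) (domK D) (JcK D) (VK D) (ℓK D k hk) (domEmb D.toTwoRuns (k + 1) Z) (InnerLabel.ofTorus hk ℓ) 0
              ((0 : B13HistM (PW D)) + wW D))
            ((tgeometry 4 (D.cubesPerDir (k + 1))).cubes (X₀ (D.cubesPerDir (k + 1)))) -
        locE (tgeometry 4 (D.cubesPerDir (k + 1))).ι (tgeometry 4 (D.cubesPerDir (k + 1))).cubes
          (fun Z => ∑ ℓ ∈ (torusLabels hk Z).filter fun ℓ =>
              ℓ.Z₀ = trefineDom D.F.L (D.cubesPerDir (k + 1)) Z ∧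
                ℓ.P ⊆ bondsOfFineCubes hk (ℓ.Z₀.1 \ ℓ.fam.biUnion fun Y : (tsys 4 (D.F.L * D.cubesPerDir (k + 1))).Dom => Y.1) ∧
                (ℓ.Z₀.1 \ ℓ.fam.biUnion fun Y : (tsys 4 (D.F.L * D.cubesPerDir (k + 1))).Dom => Y.1).card ≤ 2 * ℓ.P.card,
            actOfLetters (PW D) ℂ (𝒵K D) (domK D) (JcK D) (VK D) (ℓK D k hk) (domEmb D.toTwoRuns (k + 1) Z) (InnerLabel.ofTorus hk ℓ) 0
              (0 : B13HistM (PW D)))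
            ((tgeometry 4 (D.cubesPerDir (k + 1))).cubes (X₀ (D.cubesPerDir (k + 1))))‖ ≤ 2 * K₀ 64 8 := by
  refine (killWitnessEnd_fires D k hk U).trans (le_of_eq ?_)
  rw [zero_mul, neg_zero, Real.exp_zero, mul_one]
  unfold Acst
  have hK := K₀_pos (64 : ℝ) 8
  have he := Real.exp_pos 1
  field_simp
  ring

open Classical in
/-- **W91 §3's μ-PART END (ROAD P1's SOURCE PENCIL) — THE OWNER's N1a PART 3 UNDER THE KILL CONVENTION — FIRES AT THE CARRIERS OF
RECORD** [decided toy]: `muPart_locE_le_of_actOfLetters_recordLabels_any` APPLIED ONCE BY NAME at `ℓ₀ := ℓK D k hk` along the source pencil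
`sμ ↦ 0 + sμ • wW D` of radius `μ₁ := 2`, `A := Acst`, every other binder as in `killWitnessEnd_fires`; for `0 < μ₀ < 2`, `‖sμ‖ ≤ μ₀`.
Conclusion LITERAL. [folklore] -/
theorem killWitnessMuEnd_fires (U : D.carriers.BgB) {μ₀ : ℝ} {sμ : ℂ} (h0 : 0 < μ₀) (h02 : μ₀ < 2) (hμ : ‖sμ‖ ≤ μ₀) :
    ‖locE (tgeometry 4 (D.cubesPerDir (k + 1))).ι (tgeometry 4 (D.cubesPerDir (k + 1))).cubes
          (fun Z => ∑ ℓ ∈ (torusLabels hk Z).filter fun ℓ =>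
              ℓ.Z₀ = trefineDom D.F.L (D.cubesPerDir (k + 1)) Z ∧
                ℓ.P ⊆ bondsOfFineCubes hk (ℓ.Z₀.1 \ ℓ.fam.biUnion fun Y : (tsys 4 (D.F.L * D.cubesPerDir (k + 1))).Dom => Y.1) ∧
                (ℓ.Z₀.1 \ ℓ.fam.biUnion fun Y : (tsys 4 (D.F.L * D.cubesPerDir (k + 1))).Dom => Y.1).card ≤ 2 * ℓ.P.card,
            actOfLetters (PW D) ℂ (𝒵K D) (domK D) (JcK D) (VK D) (ℓK D k hk) (domEmb D.toTwoRuns (k + 1) Z) (InnerLabel.ofTorus hk ℓ) 0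
              ((0 : B13HistM (PW D)) + sμ • wW D))
            ((tgeometry 4 (D.cubesPerDir (k + 1))).cubes (X₀ (D.cubesPerDir (k + 1)))) -
        locE (tgeometry 4 (D.cubesPerDir (k + 1))).ι (tgeometry 4 (D.cubesPerDir (k + 1))).cubes
          (fun Z => ∑ ℓ ∈ (torusLabels hk Z).filter fun ℓ =>
              ℓ.Z₀ = trefineDom D.F.L (D.cubesPerDir (k + 1)) Z ∧
                ℓ.P ⊆ bondsOfFineCubes hk (ℓ.Z₀.1 \ ℓ.fam.biUnion fun Y : (tsys 4 (D.F.L * D.cubesPerDir (k + 1))).Dom => Y.1) ∧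
                (ℓ.Z₀.1 \ ℓ.fam.biUnion fun Y : (tsys 4 (D.F.L * D.cubesPerDir (k + 1))).Dom => Y.1).card ≤ 2 * ℓ.P.card,
            actOfLetters (PW D) ℂ (𝒵K D) (domK D) (JcK D) (VK D) (ℓK D k hk) (domEmb D.toTwoRuns (k + 1) Z) (InnerLabel.ofTorus hk ℓ) 0
              (0 : B13HistM (PW D)))
            ((tgeometry 4 (D.cubesPerDir (k + 1))).cubes (X₀ (D.cubesPerDir (k + 1))))‖ ≤
      Real.exp 1 * 9 * 64 * K₀ 64 8 ^ 2 * Acst * Real.exp (-(0 * (tsys 4 (D.cubesPerDir (k + 1))).dj (X₀ (D.cubesPerDir (k + 1))))) * (μ₀ / (2 - μ₀)) :=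
  muPart_locE_le_of_actOfLetters_recordLabels_any hk (PW D) ℂ (𝒵K D) (domK D) (JcK D) (VK D) (ℓK D k hk)
    (Win := Set.univ) (ctr := ctrW D) (ROp := fun _ => 1 / 2) (RHist := fun _ => 2) (R' := fun _ => 1)
    (mq := mqK D) (bq := bqK D) (N₀ := N₀K D k hk)
    (hroom := fun _ => by norm_num) (hm := hm_K D) (hN := hN_K D k hk) (hq := hq_K D k hk)
    (g := fun _ => 0) (hg := Set.mem_univ _) (U := U) (o := 0) (h₀ := 0) (v := wW D) (μ₁ := 2)
    (hO := by show ‖(0 : ℂ) - 0‖ ≤ 1 / 2; simp)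
    (hH := by show ‖(0 : B13HistM (PW D)) - 0‖ + 2 * ‖(wW D)‖ ≤ 2; rw [sub_zero, norm_zero, zero_add]; linarith [norm_wW_le D, sW_le])
    (A := Acst) (Rkp := RcK) (r₁ := 0) (X₀ := X₀ (D.cubesPerDir (k + 1))) (sμ := sμ)
    (hA := Acst_pos.le) (hr₁ := le_rfl) (hrate := hrate_K)
    (hsmall := by have h := hsmall_W; rwa [show (0 : ℝ) + 2 * (Acst / 2) = Acst by ring] at h)
    (δ := 1) (κ := δκK) (α₆ := α₆K) (Rc := RcK) (s := 0) (t := 0)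
    (hα₆ := α₆K_pos.le) (hκ := hκ_K) (h229 := h229_K) (hs0 := le_rfl) (hs1 := zero_le_one) (ht := le_rfl) (hRR := hRR_K D)
    (hAmp := hAmp_K D k hk) (h0 := h0) (h01 := h02) (hμ := hμ)

open Classical in
/-- … in CLOSED FORM: `≤ K₀(64,8)·μ₀∕(2 − μ₀)`. [folklore] -/
theorem killWitnessMuEnd_fires_closed (U : D.carriers.BgB) {μ₀ : ℝ} {sμ : ℂ} (h0 : 0 < μ₀) (h02 : μ₀ < 2) (hμ : ‖sμ‖ ≤ μ₀) :
    ‖locE (tgeometry 4 (D.cubesPerDir (k + 1))).ι (tgeometry 4 (D.cubesPerDir (k + 1))).cubes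
          (fun Z => ∑ ℓ ∈ (torusLabels hk Z).filter fun ℓ =>
              ℓ.Z₀ = trefineDom D.F.L (D.cubesPerDir (k + 1)) Z ∧
                ℓ.P ⊆ bondsOfFineCubes hk (ℓ.Z₀.1 \ ℓ.fam.biUnion fun Y : (tsys 4 (D.F.L * D.cubesPerDir (k + 1))).Dom => Y.1) ∧
                (ℓ.Z₀.1 \ ℓ.fam.biUnion fun Y : (tsys 4 (D.F.L * D.cubesPerDir (k + 1))).Dom => Y.1).card ≤ 2 * ℓ.P.card,
            actOfLetters (PW D) ℂ (𝒵K D) (domK D) (JcK D) (VK D) (ℓK D k hk) (domEmb D.toTwoRuns (k + 1) Z) (InnerLabel.ofTorus hk ℓ) 0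
              ((0 : B13HistM (PW D)) + sμ • wW D))
            ((tgeometry 4 (D.cubesPerDir (k + 1))).cubes (X₀ (D.cubesPerDir (k + 1)))) -
        locE (tgeometry 4 (D.cubesPerDir (k + 1))).ι (tgeometry 4 (D.cubesPerDir (k + 1))).cubes
          (fun Z => ∑ ℓ ∈ (torusLabels hk Z).filter fun ℓ =>
              ℓ.Z₀ = trefineDom D.F.L (D.cubesPerDir (k + 1)) Z ∧
                ℓ.P ⊆ bondsOfFineCubes hk (ℓ.Z₀.1 \ ℓ.fam.biUnion fun Y : (tsys 4 (D.F.L * D.cubesPerDir (k + 1))).Dom => Y.1) ∧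
                (ℓ.Z₀.1 \ ℓ.fam.biUnion fun Y : (tsys 4 (D.F.L * D.cubesPerDir (k + 1))).Dom => Y.1).card ≤ 2 * ℓ.P.card,
            actOfLetters (PW D) ℂ (𝒵K D) (domK D) (JcK D) (VK D) (ℓK D k hk) (domEmb D.toTwoRuns (k + 1) Z) (InnerLabel.ofTorus hk ℓ) 0
              (0 : B13HistM (PW D)))
            ((tgeometry 4 (D.cubesPerDir (k + 1))).cubes (X₀ (D.cubesPerDir (k + 1))))‖ ≤ K₀ 64 8 * (μ₀ / (2 - μ₀)) := by
  refine (killWitnessMuEnd_fires D k hk U h0 h02 hμ).trans (le_of_eq ?_)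
  rw [zero_mul, neg_zero, Real.exp_zero, mul_one]
  unfold Acst
  have hK := K₀_pos (64 : ℝ) 8
  have he := Real.exp_pos 1
  field_simp

end Summit.QuantumFields.BalabanUV.T4Continuum.NE1p.DressedSmallFieldRecordLabelsKillWitness

end
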